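import Summits.CriticalPhenomena.PercolationContinuityZ3.Theorems.PercNearOneGluingNoHeavyLowerTailCILCutObserverSteiner
import HarnessLib

/-!
# `NoHeavyLowerTail` (stmt-CriticalPhenomena-4575) — CIL for SEPARATED HULLS and for all FORESTS

Support file (prover `prim-hp-5`, technique "blob-quotient induction"; `--supports
stmt-CriticalPhenomena-4575`).  No definitions, no named facts, no sorries.

`μ = prodBernoulli w` on `Fin n`, relays `A ≠ ∅`, observer `o ∉ A`, level `j`, `N = |{x ∈ A : o ↔ x}|`,
`π(c) = {x ∈ A : c ↔ x}`; `Γ` = the graph of positive pairs (`SimpleGraph.fromRel (w s(x,y) ≠ 0)`), `Γ₀` its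
restriction to non-relays; the HULL of `o` = the vertices `Γ₀`-joined to `o` (`o` and the Steiner vertices
reachable from `o` through Steiner vertices).

**Theorem (`CutObserver.SteinerPorts.tform_separatedHull`, `cumulativeIsolation_separatedHull`).**  If every
positive pair at a hull vertex is a BRIDGE of `Γ` (no cycle of positive pairs passes through the hull; the
weights, the marking and the structure below the relay ports are arbitrary), then some relay `c` satisfies the
T-form `μ{1 ≤ N ≤ j} ≤ μ{1 ≤ N ∧ |π(c)| ≤ j}`, hence the conclusion of the registered stub
`stub_cumulativeIsolation` (`∃ a ∈ A, μ{1 ≤ N ≤ j} ≤ μ{|π(a)| ≤ j}`), at every level.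
**Corollary (`tform_forest`, `cumulativeIsolation_forest`).**  The same at every observer whenever `Γ` is a
FOREST (`Γ.IsAcyclic`).

Proof = induction over the hull (`tform_separatedHull_inside`, strong induction on the size of the vertex set
`U` inside which everything is read): the branches at `o` are the classes of `U ∖ o` under positive pairs
inside `U ∖ o`; a class is attached to `o` by at most one positive pair (two pairs would put the bridge on a
cycle), no positive pair joins two classes, so `CutObserver.SteinerPorts.tform_transfer`
(file `…CILCutObserverSteiner`) applies, the branch witnesses being the relay ports themselves, or — at
Steiner ports, which are hull vertices — the witnesses supplied by the induction hypothesis inside the class.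
This class strictly contains the cut observer with relay ports (`Theorems.cumulativeIsolation_cutObserver`),
the Steiner paths ending at `o`, and every tree; numerics (exact partition DP, lab/trees3.py): 0 violations in
2 369 random trees, `n ≤ 9`, extreme weights (equality only on the glue locus).
-/

noncomputable section

namespace Summit.CriticalPhenomena.PercolationContinuityZ3.Theorems

open MeasureTheory Set Literature.Probability.LatticeModels Literature.Probability.Percolation
open scoped Classical BigOperators

variable {n : ℕ}

namespace CutObserver

namespace SteinerPorts

/-! ### Separated hulls: the T-form (hence CIL) whenever no cycle of positive pairs passes through the hull -/

section SeparatedHull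

variable (w : Sym2 (Fin n) → unitInterval) (A : Finset (Fin n)) (j : ℕ) (o₀ : Fin n)

/-- **Induction over a separated hull.**  Let `Γ` be the graph of positive pairs and `Γ₀` its restriction to
non-relay vertices; the HULL of `o₀ ∉ A` is the set of vertices `Γ₀`-joined to `o₀`.  Suppose every positive
pair at a hull vertex is a bridge of `Γ` (no cycle of positive pairs passes through the hull).  Then inside
every vertex set `U`, at every hull vertex `o ∈ U` seeing a relay in `U`, some relay `c ∈ U` satisfies the
T-form `μ{1 ≤ N ≤ j} ≤ μ{1 ≤ N ∧ |π(c)| ≤ j}` (read inside `U`).  Strong induction on `|U|`: the branches at `o`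
are the classes of `U ∖ o` under positive pairs, each attached to `o` by at most one pair (two pairs into
one class would put the bridge `o–p` on a cycle), no positive pair joins two classes, and
`CutObserver.SteinerPorts.tform_transfer` applies with the branch witnesses supplied by the induction
hypothesis at the Steiner ports (which are hull vertices) or by the relay ports themselves. [folklore] -/
theorem tform_separatedHull_inside
    (hH : ∀ v u : Fin n,
      (SimpleGraph.fromRel fun x y : Fin n => x ∉ A ∧ y ∉ A ∧ w s(x, y) ≠ 0).Reachable o₀ v →
      (SimpleGraph.fromRel fun x y : Fin n => w s(x, y) ≠ 0).Adj v u →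
      (SimpleGraph.fromRel fun x y : Fin n => w s(x, y) ≠ 0).IsBridge s(v, u)) :
    ∀ (m : ℕ) (U : Finset (Fin n)), U.card = m → ∀ o ∈ U, o ∉ A →
      (SimpleGraph.fromRel fun x y : Fin n => x ∉ A ∧ y ∉ A ∧ w s(x, y) ≠ 0).Reachable o₀ o →
      (∃ x ∈ U, x ∈ A) →
      ∃ c ∈ U, c ∈ A ∧
        (prodBernoulli w).real {ω : BondConfig (Fin n) |
            1 ≤ (A.filter fun x => (openGraph (ω ∩ ↑(U.sym2))).Reachable o x).card ∧
              (A.filter fun x => (openGraph (ω ∩ ↑(U.sym2))).Reachable o x).card ≤ j} ≤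
          (prodBernoulli w).real {ω : BondConfig (Fin n) |
            1 ≤ (A.filter fun x => (openGraph (ω ∩ ↑(U.sym2))).Reachable o x).card ∧
              (A.filter fun x => (openGraph (ω ∩ ↑(U.sym2))).Reachable c x).card ≤ j} := by
  set Γ : SimpleGraph (Fin n) := SimpleGraph.fromRel fun x y : Fin n => w s(x, y) ≠ 0 with hΓ
  set Γ₀ : SimpleGraph (Fin n) :=
    SimpleGraph.fromRel fun x y : Fin n => x ∉ A ∧ y ∉ A ∧ w s(x, y) ≠ 0 with hΓ₀
  intro m
  induction m using Nat.strong_induction_on with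
  | _ m IH =>
  intro U hUm o hoU hoA hhull hxA
  -- ### the classes of `U ∖ o` under positive pairs
  set U' := U.erase o with hU'
  set Γ' : SimpleGraph (Fin n) := SimpleGraph.fromRel fun x y : Fin n => x ∈ U' ∧ y ∈ U' ∧ w s(x, y) ≠ 0
    with hΓ'
  have hΓ'adj : ∀ x y, Γ'.Adj x y ↔ x ≠ y ∧ x ∈ U' ∧ y ∈ U' ∧ w s(x, y) ≠ 0 := by
    intro x y
    rw [hΓ', SimpleGraph.fromRel_adj]
    constructor
    · rintro ⟨hne, h | h⟩
      · exact ⟨hne, h⟩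
      · exact ⟨hne, h.2.1, h.1, by rw [Sym2.eq_swap]; exact h.2.2⟩
    · rintro ⟨hne, h⟩
      exact ⟨hne, Or.inl h⟩
  set comp : Fin n → Finset (Fin n) := fun v => U'.filter fun x => Γ'.Reachable v x with hcomp
  have hmem_comp : ∀ {v x}, x ∈ comp v ↔ x ∈ U' ∧ Γ'.Reachable v x := by
    intro v x; simp only [hcomp, Finset.mem_filter]
  have hself : ∀ {v}, v ∈ U' → v ∈ comp v := fun hv => hmem_comp.2 ⟨hv, SimpleGraph.Reachable.refl _⟩
  have hcomp_eq : ∀ {v x}, x ∈ comp v → comp x = comp v := by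
    intro v x hx
    obtain ⟨-, hvx⟩ := hmem_comp.1 hx
    ext y
    simp only [hmem_comp]
    exact ⟨fun ⟨hy, hxy⟩ => ⟨hy, hvx.trans hxy⟩, fun ⟨hy, hvy⟩ => ⟨hy, hvx.symm.trans hvy⟩⟩
  have hcomp_sub : ∀ v, comp v ⊆ U' := fun v x hx => (hmem_comp.1 hx).1
  -- two distinct positive neighbours of `o` in `U'` lie in different classes (the pair `o–u₁` is a bridge)
  have hbridge : ∀ {u₁ u₂}, u₁ ∈ U' → u₂ ∈ U' → w s(o, u₁) ≠ 0 → w s(o, u₂) ≠ 0 → u₁ ≠ u₂ →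
      ¬ Γ'.Reachable u₁ u₂ := by
    intro u₁ u₂ hu₁ hu₂ hw₁ hw₂ hne hreach
    have ho₁ : o ≠ u₁ := fun h => (Finset.mem_erase.1 hu₁).1 h.symm
    have ho₂ : o ≠ u₂ := fun h => (Finset.mem_erase.1 hu₂).1 h.symm
    have hadj₁ : Γ.Adj o u₁ := by rw [hΓ, SimpleGraph.fromRel_adj]; exact ⟨ho₁, Or.inl hw₁⟩
    have hadj₂ : Γ.Adj o u₂ := by rw [hΓ, SimpleGraph.fromRel_adj]; exact ⟨ho₂, Or.inl hw₂⟩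
    have hbr := hH o u₁ hhull hadj₁
    rw [SimpleGraph.isBridge_iff] at hbr
    apply hbr
    have hle : Γ' ≤ Γ.deleteEdges {s(o, u₁)} := by
      intro x y hxy
      obtain ⟨hne', hx, hy, hw⟩ := (hΓ'adj x y).1 hxy
      rw [SimpleGraph.deleteEdges_adj]
      refine ⟨by rw [hΓ, SimpleGraph.fromRel_adj]; exact ⟨hne', Or.inl hw⟩, ?_⟩
      rw [Set.mem_singleton_iff, Sym2.eq_iff]
      rintro (⟨rfl, -⟩ | ⟨-, rfl⟩)
      · exact (Finset.mem_erase.1 hx).1 rfl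
      · exact (Finset.mem_erase.1 hy).1 rfl
    have h2 : (Γ.deleteEdges {s(o, u₁)}).Adj o u₂ := by
      rw [SimpleGraph.deleteEdges_adj]
      refine ⟨hadj₂, ?_⟩
      rw [Set.mem_singleton_iff, Sym2.eq_iff]
      rintro (⟨-, h⟩ | ⟨h, -⟩)
      · exact hne h.symm
      · exact ho₁ h
    exact h2.reachable.trans ((hreach.mono hle).symm)
  -- ### the branch decomposition
  set 𝒞 := U'.image comp with h𝒞
  set d := 𝒞.card with hd
  set e := 𝒞.equivFin with he
  set V : Fin d → Finset (Fin n) := fun l => (e.symm l).1 with hV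
  have hVmem : ∀ l, V l ∈ 𝒞 := fun l => (e.symm l).2
  have hVrep : ∀ l, ∃ v ∈ U', V l = comp v := by
    intro l
    obtain ⟨v, hv, hcv⟩ := Finset.mem_image.1 (hVmem l)
    exact ⟨v, hv, hcv.symm⟩
  have hVsub : ∀ l, V l ⊆ U' := by
    intro l; obtain ⟨v, -, hv⟩ := hVrep l; rw [hv]; exact hcomp_sub v
  have hVcomp : ∀ l, ∀ x ∈ V l, comp x = V l := by
    intro l x hx; obtain ⟨v, -, hv⟩ := hVrep l; rw [hv] at hx ⊢; exact hcomp_eq hx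
  have hVinj : ∀ l l', V l = V l' → l = l' := by
    intro l l' h
    have : e.symm l = e.symm l' := Subtype.ext h
    exact e.symm.injective this
  have hdisj : ∀ l l', l ≠ l' → Disjoint (V l) (V l') := by
    intro l l' hll'
    rw [Finset.disjoint_left]
    intro x hx hx'
    exact hll' (hVinj l l' ((hVcomp l x hx).symm.trans (hVcomp l' x hx')))
  have hcover : ∀ v ∈ U, v ≠ o → ∃ l, v ∈ V l := by
    intro v hv hvo
    have hv' : v ∈ U' := Finset.mem_erase.2 ⟨hvo, hv⟩
    refine ⟨e ⟨comp v, Finset.mem_image.2 ⟨v, hv', rfl⟩⟩, ?_⟩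
    simp only [hV, Equiv.symm_apply_apply]
    exact hself hv'
  have hoV : ∀ l, o ∉ V l := fun l h => (Finset.mem_erase.1 (hVsub l h)).1 rfl
  have hVW : ∀ l, V l ⊆ U := fun l x hx => (Finset.mem_erase.1 (hVsub l hx)).2
  have hVne : ∀ l, (V l).Nonempty := by
    intro l; obtain ⟨v, hv, hcv⟩ := hVrep l; exact ⟨v, hcv ▸ hself hv⟩
  -- ports: the attached vertex if any, else a relay if any, else anything
  have hport : ∀ l, ∃ q ∈ V l, (∀ x ∈ V l, x ≠ q → w s(o, x) = 0) ∧
      ((∃ x ∈ V l, x ∈ A) → q ∉ A → w s(o, q) ≠ 0) := by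
    intro l
    by_cases h : ∃ x ∈ V l, w s(o, x) ≠ 0
    · obtain ⟨q, hq, hwq⟩ := h
      refine ⟨q, hq, fun x hx hxq => ?_, fun _ _ => hwq⟩
      by_contra hwx
      refine hbridge (hVsub l hx) (hVsub l hq) hwx hwq hxq ?_
      have hq' : q ∈ comp x := (hVcomp l x hx).symm ▸ hq
      exact (hmem_comp.1 hq').2
    · push Not at h
      by_cases hA' : ∃ x ∈ V l, x ∈ A
      · obtain ⟨q, hq, hqA⟩ := hA'
        exact ⟨q, hq, fun x hx _ => h x hx, fun _ hqA' => absurd hqA hqA'⟩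
      · obtain ⟨q, hq⟩ := hVne l
        exact ⟨q, hq, fun x hx _ => h x hx, fun hl _ => absurd hl hA'⟩
  choose p hpV hobs hpatt using hport
  have hsep : ∀ l l', l ≠ l' → ∀ u ∈ V l, ∀ v ∈ V l', w s(u, v) = 0 := by
    intro l l' hll' u hu v hv
    by_contra hw
    have huv : u ≠ v := by
      rintro rfl
      exact Finset.disjoint_left.1 (hdisj l l' hll') hu hv
    have hadj : Γ'.Adj u v := (hΓ'adj u v).2 ⟨huv, hVsub l hu, hVsub l' hv, hw⟩
    have hvU : v ∈ comp u := hmem_comp.2 ⟨hVsub l' hv, hadj.reachable⟩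
    rw [hVcomp l u hu] at hvU
    exact Finset.disjoint_left.1 (hdisj l l' hll') hvU hv
  -- a Steiner port of a live branch is attached, hence a hull vertex
  have hphull : ∀ l, p l ∉ A → (∃ x ∈ V l, x ∈ A) → Γ₀.Reachable o₀ (p l) := by
    intro l hpl hlive
    have hw := hpatt l hlive hpl
    refine hhull.trans (SimpleGraph.Adj.reachable ?_)
    rw [hΓ₀, SimpleGraph.fromRel_adj]
    exact ⟨fun h => hoV l (h ▸ hpV l), Or.inl ⟨hoA, hpl, hw⟩⟩
  -- ### branch witnesses: relay port, or the induction hypothesis inside the branch, or (dead) the port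
  have hIH : ∀ l, p l ∉ A → (∃ x ∈ V l, x ∈ A) → ∃ c ∈ V l, c ∈ A ∧
      (prodBernoulli w).real {ω : BondConfig (Fin n) |
          1 ≤ (A.filter fun x => (openGraph (ω ∩ ↑((V l).sym2))).Reachable (p l) x).card ∧
            (A.filter fun x => (openGraph (ω ∩ ↑((V l).sym2))).Reachable (p l) x).card ≤ j} ≤
        (prodBernoulli w).real {ω : BondConfig (Fin n) |
          1 ≤ (A.filter fun x => (openGraph (ω ∩ ↑((V l).sym2))).Reachable (p l) x).card ∧
            (A.filter fun x => (openGraph (ω ∩ ↑((V l).sym2))).Reachable c x).card ≤ j} := by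
    intro l hpl hlive
    have hlt : (V l).card < m := by
      rw [← hUm]
      exact Finset.card_lt_card ⟨hVW l, fun h => hoV l (h hoU)⟩
    exact IH (V l).card hlt (V l) rfl (p l) (hpV l) hpl (hphull l hpl hlive) hlive
  set a : Fin d → Fin n := fun l =>
    if hp : p l ∈ A then p l
    else if hl : (∃ x ∈ V l, x ∈ A) then (hIH l hp hl).choose else p l with ha
  have haV : ∀ l, a l ∈ V l := by
    intro l
    simp only [ha]
    split_ifs with hp hl
    · exact hpV l
    · exact (hIH l hp hl).choose_spec.1
    · exact hpV l
  have halive : ∀ l, (∃ x ∈ V l, x ∈ A) → a l ∈ A := by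
    intro l hl
    simp only [ha]
    split_ifs with hp
    · exact hp
    · exact (hIH l hp hl).choose_spec.2.1
  have hdead : ∀ l, a l ∉ A → ∀ x ∈ V l, x ∉ A := fun l hal x hx hxA => hal (halive l ⟨x, hx, hxA⟩)
  have hT : ∀ l, a l ∈ A →
      (prodBernoulli w).real {ω : BondConfig (Fin n) |
          1 ≤ (A.filter fun x => (openGraph (ω ∩ ↑((V l).sym2))).Reachable (p l) x).card ∧
            (A.filter fun x => (openGraph (ω ∩ ↑((V l).sym2))).Reachable (p l) x).card ≤ j} ≤
        (prodBernoulli w).real {ω : BondConfig (Fin n) |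
          1 ≤ (A.filter fun x => (openGraph (ω ∩ ↑((V l).sym2))).Reachable (p l) x).card ∧
            (A.filter fun x => (openGraph (ω ∩ ↑((V l).sym2))).Reachable (a l) x).card ≤ j} := by
    intro l hal
    by_cases hp : p l ∈ A
    · have : a l = p l := by simp only [ha, dif_pos hp]
      rw [this]
    · have hl : ∃ x ∈ V l, x ∈ A := ⟨a l, haV l, hal⟩
      have : a l = (hIH l hp hl).choose := by simp only [ha, dif_neg hp, dif_pos hl]
      rw [this]
      exact (hIH l hp hl).choose_spec.2.2
  -- ### a live branch, the best one, and the transfer theorem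
  obtain ⟨x₀, hx₀U, hx₀A⟩ := hxA
  have hx₀o : x₀ ≠ o := fun h => hoA (h ▸ hx₀A)
  obtain ⟨l₀, hl₀⟩ := hcover x₀ hx₀U hx₀o
  have hlive₀ : a l₀ ∈ A := halive l₀ ⟨x₀, hl₀, hx₀A⟩
  set tl : Fin d → ℝ := fun l => (prodBernoulli w).real {ω : BondConfig (Fin n) |
    (A.filter fun x => (openGraph (ω ∩ ↑((V l).sym2))).Reachable (a l) x).card ≤ j} with htl
  obtain ⟨i, hi, himax⟩ := Finset.exists_max_image (Finset.univ.filter fun l => a l ∈ A) tl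
    ⟨l₀, Finset.mem_filter.2 ⟨Finset.mem_univ _, hlive₀⟩⟩
  have hiA : a i ∈ A := (Finset.mem_filter.1 hi).2
  refine ⟨a i, hVW i (haV i), hiA, ?_⟩
  exact tform_transfer w A U o j V p a i hoA hpV haV hoV hdisj hoU hVW hcover hobs hsep hdead hT hiA
    (fun l hl => himax l (Finset.mem_filter.2 ⟨Finset.mem_univ _, hl⟩))

/-- **The T-form for a separated hull.**  If every positive pair at a vertex of the hull of `o ∉ A`
(`o` and the non-relays joined to `o` through non-relays by positive pairs) is a bridge of the graph of
positive pairs — equivalently no cycle of positive pairs passes through the hull; arbitrary weights,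
arbitrary structure below the relay ports — then some relay `c` has `μ{1 ≤ N ≤ j} ≤ μ{1 ≤ N ∧ |π(c)| ≤ j}`.
[folklore] -/
theorem tform_separatedHull (ho : o₀ ∉ A) (hA : A.Nonempty)
    (hH : ∀ v u : Fin n,
      (SimpleGraph.fromRel fun x y : Fin n => x ∉ A ∧ y ∉ A ∧ w s(x, y) ≠ 0).Reachable o₀ v →
      (SimpleGraph.fromRel fun x y : Fin n => w s(x, y) ≠ 0).Adj v u →
      (SimpleGraph.fromRel fun x y : Fin n => w s(x, y) ≠ 0).IsBridge s(v, u)) :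
    ∃ c ∈ A,
      (prodBernoulli w).real {ω : BondConfig (Fin n) |
          1 ≤ (A.filter fun x => ω ∈ openConn o₀ x).card ∧
            (A.filter fun x => ω ∈ openConn o₀ x).card ≤ j} ≤
        (prodBernoulli w).real {ω : BondConfig (Fin n) |
          1 ≤ (A.filter fun x => ω ∈ openConn o₀ x).card ∧
            (A.filter fun x => ω ∈ openConn c x).card ≤ j} := by
  obtain ⟨x₀, hx₀⟩ := hA
  obtain ⟨c, -, hcA, h⟩ := tform_separatedHull_inside w A j o₀ hH _ Finset.univ rfl o₀
    (Finset.mem_univ o₀) ho (SimpleGraph.Reachable.refl _) ⟨x₀, Finset.mem_univ _, hx₀⟩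
  refine ⟨c, hcA, ?_⟩
  have e1 : ∀ (y : Fin n) (ω : BondConfig (Fin n)),
      (A.filter fun x => (openGraph (ω ∩ ↑((Finset.univ : Finset (Fin n)).sym2))).Reachable y x) =
        (A.filter fun x => ω ∈ openConn y x) := fun y ω =>
    Finset.filter_congr fun x _ => by rw [inter_univ_sym2]; exact Iff.rfl
  simp only [e1] at h
  exact h

/-- **CIL for a separated hull** — the conclusion of the registered stub `stub_cumulativeIsolation` whenever
no cycle of positive pairs passes through the hull of the observer. [folklore] -/
theorem cumulativeIsolation_separatedHull (ho : o₀ ∉ A) (hA : A.Nonempty)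
    (hH : ∀ v u : Fin n,
      (SimpleGraph.fromRel fun x y : Fin n => x ∉ A ∧ y ∉ A ∧ w s(x, y) ≠ 0).Reachable o₀ v →
      (SimpleGraph.fromRel fun x y : Fin n => w s(x, y) ≠ 0).Adj v u →
      (SimpleGraph.fromRel fun x y : Fin n => w s(x, y) ≠ 0).IsBridge s(v, u)) :
    ∃ c ∈ A,
      (prodBernoulli w).real {ω : BondConfig (Fin n) |
          1 ≤ (A.filter fun x => ω ∈ openConn o₀ x).card ∧
            (A.filter fun x => ω ∈ openConn o₀ x).card ≤ j} ≤
        (prodBernoulli w).real {ω : BondConfig (Fin n) |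
          (A.filter fun x => ω ∈ openConn c x).card ≤ j} := by
  obtain ⟨c, hc, h⟩ := tform_separatedHull w A j o₀ ho hA hH
  exact ⟨c, hc, le_trans h (measureReal_mono (fun ω hω => hω.2) (measure_ne_top _ _))⟩

/-- **The T-form on forests.**  If the positive-weight pairs of `w` form a forest (arbitrary weights,
arbitrary relay set `A ≠ ∅`, observer `o ∉ A`), then some relay `c` satisfies
`μ{1 ≤ N ≤ j} ≤ μ{1 ≤ N ∧ |π(c)| ≤ j}` at every level `j`. [folklore] -/
theorem tform_forest (hF : (SimpleGraph.fromRel fun x y : Fin n => w s(x, y) ≠ 0).IsAcyclic)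
    (ho : o₀ ∉ A) (hA : A.Nonempty) :
    ∃ c ∈ A,
      (prodBernoulli w).real {ω : BondConfig (Fin n) |
          1 ≤ (A.filter fun x => ω ∈ openConn o₀ x).card ∧
            (A.filter fun x => ω ∈ openConn o₀ x).card ≤ j} ≤
        (prodBernoulli w).real {ω : BondConfig (Fin n) |
          1 ≤ (A.filter fun x => ω ∈ openConn o₀ x).card ∧
            (A.filter fun x => ω ∈ openConn c x).card ≤ j} :=
  tform_separatedHull w A j o₀ ho hA fun _ _ _ hadj =>
    SimpleGraph.isAcyclic_iff_forall_adj_isBridge.1 hF hadj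

/-- **CIL on forests** — the conclusion of the registered stub `stub_cumulativeIsolation` whenever the
positive-weight pairs form a forest: `∃ a ∈ A, μ{1 ≤ N ≤ j} ≤ μ{|π(a)| ≤ j}`. [folklore] -/
theorem cumulativeIsolation_forest
    (hF : (SimpleGraph.fromRel fun x y : Fin n => w s(x, y) ≠ 0).IsAcyclic)
    (ho : o₀ ∉ A) (hA : A.Nonempty) :
    ∃ c ∈ A,
      (prodBernoulli w).real {ω : BondConfig (Fin n) |
          1 ≤ (A.filter fun x => ω ∈ openConn o₀ x).card ∧
            (A.filter fun x => ω ∈ openConn o₀ x).card ≤ j} ≤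
        (prodBernoulli w).real {ω : BondConfig (Fin n) |
          (A.filter fun x => ω ∈ openConn c x).card ≤ j} :=
  cumulativeIsolation_separatedHull w A j o₀ ho hA fun _ _ _ hadj =>
    SimpleGraph.isAcyclic_iff_forall_adj_isBridge.1 hF hadj

end SeparatedHull

end SteinerPorts

end CutObserver

end Summit.CriticalPhenomena.PercolationContinuityZ3.Theorems

end
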